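import Summits.HodgeConjecture.HodgeConjecture.Theorems.Q8SymplecticPowersLoc6Defs
import Summits.HodgeConjecture.HodgeConjecture.Theorems.Q8MonodromyBireflectionLocalConfigurationMV
import Summits.HodgeConjecture.HodgeConjecture.Theorems.Q8MonodromyBireflectionTransport
import Summits.HodgeConjecture.HodgeConjecture.Theorems.Q8SymplecticPowersRegularOfOneFibre
import HarnessLib

/-!
# K1Q stub S5 (v6) CLOSED MODULO the geometric monodromy datum: `GeometricMonodromyDatumQ → MonodromyBireflectionQ`

Sub-problem `HodgeConjecture`, route `Summits/HodgeConjecture/HodgeConjecture/Theses/Q8SymplecticPowers.lean` (crux K1Q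
`VeryGeneralQuaternionCommutatorsInHg`, stmt-HodgeConjecture-24190, skeleton v6 stub S5 `stub_monodromyBireflectionQ` =
`Q8SymplecticPowersLoc6Defs.MonodromyBireflectionQ` by name). Written by the prover seat `hodge-nonav-prover-Ax` (g18). HC ∕ HC_AV ∕ K1Q are
NOT proved here, and S5 is NOT proved here: this file proves S5 FROM the geometric monodromy datum of a d6 meridian at one base point
(`Q8SymplecticPowersLoc6Defs.GeometricMonodromyDatumQ`, memo `LOC6-ARCHITECTURE-Ax-g18.md` §8 (G)), by

* `Q8MonodromyBireflectionAssembly.monodromyBireflection_of_localConfigurationMV` (the clause at the point carrying the datum), and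
* `Q8MonodromyBireflectionAssembly.clause_transport_family_of_pathConnected` with
  `Q8SymplecticPowersRegularOfOneFibre.pathConnectedSpace_complexPoints_base` (the clause at every base point).
-/

noncomputable section

set_option backward.isDefEq.respectTransparency false
set_option linter.dupNamespace false

open CategoryTheory CategoryTheory.Limits AlgebraicGeometry
open Literature.AlgebraicTopology.SingularHomology Literature.AlgebraicGeometry Literature.AlgebraicGeometry.Motives
open Literature.AlgebraicGeometry.HodgeTheory Literature.AlgebraicGeometry.HodgeTheory.BettiUniverse
open Literature.AlgebraicGeometry.HodgeTheory.Q8Family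

namespace Summit.HodgeConjecture.HodgeConjecture.Theorems.Q8SymplecticPowersLoc6Defs

open Summit.HodgeConjecture.HodgeConjecture.Theorems.Q8MonodromyBireflectionAssembly
open Summit.HodgeConjecture.HodgeConjecture.Theorems.Q8SymplecticPowersRegularOfOneFibre

/-- **S5-v6 from the geometric monodromy datum.** [cite: VoisinHodgeII2003, §3.1.2 and §3.2.1] -/
theorem monodromyBireflectionQ_of_geometricMonodromyDatum (hG : GeometricMonodromyDatumQ) : MonodromyBireflectionQ := by
  unfold MonodromyBireflectionQ
  unfold GeometricMonodromyDatumQ at hG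
  intro e he h4e W 𝒳 π τ j ι hne hπ h𝒳 hS hsm hτπ hjπ h4 hjj hτjτ hιo hιπ hτι hjι hsurj hU s
  obtain ⟨s₀, ⟨D⟩⟩ := hG he h4e W 𝒳 π τ j ι hne hπ h𝒳 hS hsm hτπ hjπ h4 hjj hτjτ hιo hιπ hτι hjι hsurj hU
  haveI := hsm
  haveI : PathConnectedSpace (ComplexPoints (base W)) := pathConnectedSpace_complexPoints_base (m := Fintype.card (CIdx e)) W hne
  haveI := D.hfinV₁
  haveI := D.hfinV₂
  exact clause_transport_family_of_pathConnected π hτπ hπ hS (d := Fintype.card (CIdx e)) hjπ hU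
    (monodromyBireflection_of_localConfigurationMV π hτπ D.hζ hπ h𝒳 hS hjπ h4 hjj hτjτ hU s₀ D.γ D.hγΓ D.hγ1 D.h D.hγh D.hhμ D.hhτ
      D.h1o D.h2o D.hBo D.hcov D.hdisj D.hB D.hhA₁ D.hhA₂ D.hτA₁ D.hτA₂ D.hjA₁ D.hjA₂
      D.hUo₁ D.hVo₁ D.hUV₁ D.hI₁₁ D.hI₀₁ D.hsU₁ D.hsV₁ D.hgU₁ D.hsV2₁ D.e₁ D.heg₁ D.hes₁
      D.hUo₂ D.hVo₂ D.hUV₂ D.hI₁₂ D.hI₀₂ D.hsU₂ D.hsV₂ D.hgU₂ D.hsV2₂ D.e₂ D.heg₂ D.hes₂) s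

end Summit.HodgeConjecture.HodgeConjecture.Theorems.Q8SymplecticPowersLoc6Defs

end
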